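import Summits.CriticalPhenomena.PercolationContinuityZ3.Theorems.PercNearOneGluingNoHeavyQuantDECPeel
import HarnessLib

/-!
# QUANT lane R8, T-DEC: THE TWO-LOW PEELING LEMMA — a law whose low atoms are `0` and TWO positive atoms `lo₁ < lo₂` is DEC at the target at
# every layer as soon as one common partner `P` can take both at the common gate `γ = max(y, (T − 2lo₁)/(P − lo₁))` (capacity
# `(μ lo₁ + μ lo₂)·γ ≤ μ P·(1−γ)`) and both pair means stay `≤ T` (census-1 gen 24)

builds on p205010 (kernel theorem, internal audit signed; external expert review pending)

Support file (`--supports stmt-CriticalPhenomena-4575`), QUANT lane seat prim-quant-census-1 (gen 24); memo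
`run/shared/lean/prim/quant/prim-quant-census-1/RESID-DEC-G24.md` §3/§6.  Theorems only (no definitions, no `@[conjecture]`), standard axioms, no
sorries.  Sequel of this seat's `…QuantDECOneLow` (one positive low atom) and `…QuantDECPeel` (`decAtT_all_of_pairs_noLow`, the certificate format);
used by `…QuantGappedForestSDEC` (the gapped triple `(R¹[q](R³[s]))³`, low atoms `2` and `3` at `a·fmean > 6`).

THE LEMMA (`decAtT_all_of_twoLow`).  `μ ≥ 0` on `{0..M}`, mass `1`, mean `T`, `μ 0 > 0`, floor `0 < y < 1`, `y·M ≤ T`; positive low atoms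
`lo₁ < lo₂` (`2·lo₂ < T`), every OTHER charged positive atom self-sufficient; a common partner `lo₂ < P ≤ M` with `T < lo₁ + P`; the common gate
`γ := max(y, (T − 2lo₁)/(P − lo₁))` — valid for BOTH pairs at every layer (`γ ≥ y`; credit `≥ T` for `lo₁` by construction, for `lo₂` because
`(lo₂ − lo₁)(2P − T) ≥ 0`); CAPACITY `(μ lo₁ + μ lo₂)·γ ≤ μ P·(1−γ)` and PAIR MEANS `loᵢ + (P − loᵢ)·γ ≤ T`.  Then `DECAtT y T j′ M μ` for every
`j′`: peel `μ = λ₁·{lo₁, P; γ} + λ₂·{lo₂, P; γ} + λ₀·ν` (`λᵢ = μ loᵢ/(1−γ)`, `λ₀ > 0` as `μ 0 > 0`); `ν` has no positive low atom, mass `1`,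
mean `≥ T`; conclude with `decAtT_all_of_pairs_noLow`.

HONEST STATUS: a count-level certificate lemma; `ResidDEC`, `SiblingStep`, `GateStepN`, `FarTreeRow` OPEN; RATE class log\* / honest sentence of
`run/shared/lean/prim/quant/README.md` unchanged.  [this work]; certificate format / flow normal form: this seat, prim-quant-stmt g22.
Nothing here is cited as a published result.  The gluing rows served [cite: KozmaNitzan2024, Conjecture 3 (p. 15)]; product measure
[cite: Grimmett1999, §1.3 p. 10].
-/

noncomputable section

open scoped BigOperators

namespace Summit.CriticalPhenomena.PercolationContinuityZ3.Theorems
namespace Quant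

open Finset

/-- the two-point law `{lo, hi; g}` (as in `…QuantLawDEC`) -/
local notation3 "TP[" lo ", " hi ", " g ", " h "]" =>
  (g : ℝ) * (if (h : ℕ) = (hi : ℕ) then (1 : ℝ) else 0) + (1 - (g : ℝ)) * (if (h : ℕ) = (lo : ℕ) then (1 : ℝ) else 0)

namespace LawDec

/-! ### The two-low peeling lemma (common partner, common gate) -/

/-- **THE TWO-LOW PEELING LEMMA.**  `μ ≥ 0` on `{0..M}`, mass `1`, mean `T`, `μ 0 > 0`, floor `0 < y < 1`, `y·M ≤ T`; positive low atoms
`lo₁ < lo₂` (`2·lo₂ < T`), every OTHER charged positive atom self-sufficient; a common partner `lo₂ < P ≤ M` with `T < lo₁ + P`; the common gate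
`γ := max(y, (T − 2lo₁)/(P − lo₁))` (valid for both pairs: `γ ≥ y`, credit `≥ T` for `lo₁` by construction and for `lo₂ > lo₁` since `T < 2P`);
CAPACITY `(μ lo₁ + μ lo₂)·γ ≤ μ P·(1 − γ)` and both PAIR MEANS `loᵢ + (P − loᵢ)·γ ≤ T`.  Then `DECAtT y T j′ M μ` for every `j′`: peel
`μ = λ₁·{lo₁, P; γ} + λ₂·{lo₂, P; γ} + λ₀·ν`, `λᵢ = μ loᵢ/(1−γ)`; the remainder has no positive low atom and mean `≥ T`
(`decAtT_all_of_pairs_noLow`). [this work] -/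
theorem decAtT_all_of_twoLow (y T : ℝ) (M lo₁ lo₂ P : ℕ) (μ : ℕ → ℝ) (hy0 : 0 < y) (hy1 : y < 1)
    (hμ0 : ∀ h, 0 ≤ μ h) (hμM : ∀ h, M < h → μ h = 0) (hμ1 : ∑ h ∈ Finset.range (M + 1), μ h = 1)
    (hmean : ∑ h ∈ Finset.range (M + 1), (h : ℝ) * μ h = T) (h0 : 0 < μ 0)
    (hlo0 : 0 < lo₁) (hlt : lo₁ < lo₂) (hlow : 2 * (lo₂ : ℝ) < T) (hloP : lo₂ < P) (hPM : P ≤ M) (hcomp : T < (lo₁ : ℝ) + P)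
    (hothers : ∀ h, 1 ≤ h → h ≠ lo₁ → h ≠ lo₂ → 0 < μ h → T ≤ 2 * (h : ℝ)) (hta : y * (M : ℝ) ≤ T)
    (hm1 : (lo₁ : ℝ) + ((P : ℝ) - lo₁) * max y ((T - 2 * (lo₁ : ℝ)) / ((P : ℝ) - lo₁)) ≤ T)
    (hm2 : (lo₂ : ℝ) + ((P : ℝ) - lo₂) * max y ((T - 2 * (lo₁ : ℝ)) / ((P : ℝ) - lo₁)) ≤ T)
    (hcap : (μ lo₁ + μ lo₂) * max y ((T - 2 * (lo₁ : ℝ)) / ((P : ℝ) - lo₁)) ≤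
      μ P * (1 - max y ((T - 2 * (lo₁ : ℝ)) / ((P : ℝ) - lo₁)))) :
    ∀ j', DECAtT y T j' M μ := by
  classical
  set γ : ℝ := max y ((T - 2 * (lo₁ : ℝ)) / ((P : ℝ) - lo₁)) with hγ
  have hlo12 : (lo₁ : ℝ) < lo₂ := by exact_mod_cast hlt
  have hloP' : (lo₂ : ℝ) < P := by exact_mod_cast hloP
  have hPlo : (0 : ℝ) < (P : ℝ) - lo₁ := by linarith
  have hT0 : 0 < T := by have : (0 : ℝ) ≤ lo₂ := Nat.cast_nonneg lo₂; linarith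
  -- facts about γ
  have hyγ : y ≤ γ := le_max_left _ _
  have hργ : (T - 2 * (lo₁ : ℝ)) / ((P : ℝ) - lo₁) ≤ γ := le_max_right _ _
  have hγ0 : 0 < γ := lt_of_lt_of_le hy0 hyγ
  have hγ1 : γ < 1 := by
    refine max_lt hy1 ?_
    rw [div_lt_one hPlo]
    linarith
  have h1γ : 0 < 1 - γ := by linarith
  have hcr1 : T ≤ 2 * (lo₁ : ℝ) + ((P : ℝ) - lo₁) * γ := by
    have := mul_le_mul_of_nonneg_left hργ hPlo.le
    rw [mul_div_cancel₀ _ hPlo.ne'] at this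
    linarith
  have hcr2 : T ≤ 2 * (lo₂ : ℝ) + ((P : ℝ) - lo₂) * γ := by
    -- `(lo₂ − lo₁)(2P − T) ≥ 0` on top of the credit of the first pair at the lever gate
    have hρ : (T - 2 * (lo₁ : ℝ)) / ((P : ℝ) - lo₁) * ((P : ℝ) - lo₂) ≤ γ * ((P : ℝ) - lo₂) :=
      mul_le_mul_of_nonneg_right hργ (by linarith)
    have e : (T - 2 * (lo₁ : ℝ)) / ((P : ℝ) - lo₁) * ((P : ℝ) - lo₂)
        = (T - 2 * (lo₁ : ℝ)) * ((P : ℝ) - lo₂) / ((P : ℝ) - lo₁) := by ring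
    rw [e] at hρ
    have h2P : T < 2 * (P : ℝ) := by linarith
    have key : T - 2 * (lo₂ : ℝ) ≤ (T - 2 * (lo₁ : ℝ)) * ((P : ℝ) - lo₂) / ((P : ℝ) - lo₁) := by
      rw [le_div_iff₀ hPlo]
      nlinarith
    nlinarith
  -- the peeled weights
  have hloM₁ : lo₁ ≤ M := by omega
  have hloM₂ : lo₂ ≤ M := by omega
  have hsum4 : μ 0 + μ lo₁ + μ lo₂ + μ P ≤ 1 := by
    have hsub : ({0, lo₁, lo₂, P} : Finset ℕ) ⊆ Finset.range (M + 1) := by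
      intro h hh
      simp only [Finset.mem_insert, Finset.mem_singleton] at hh
      rw [Finset.mem_range]
      rcases hh with rfl | rfl | rfl | rfl <;> omega
    have := Finset.sum_le_sum_of_subset_of_nonneg hsub (fun h _ _ => hμ0 h)
    rw [hμ1, Finset.sum_insert (by simp; omega), Finset.sum_insert (by simp; omega), Finset.sum_insert (by simp; omega),
      Finset.sum_singleton] at this
    linarith
  set lam1 : ℝ := μ lo₁ / (1 - γ) with hlam1
  set lam2 : ℝ := μ lo₂ / (1 - γ) with hlam2
  have hlam10 : 0 ≤ lam1 := div_nonneg (hμ0 lo₁) h1γ.le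
  have hlam20 : 0 ≤ lam2 := div_nonneg (hμ0 lo₂) h1γ.le
  have hlos : μ lo₁ + μ lo₂ ≤ (1 - γ) * (1 - μ 0) := by
    have h1 : μ P ≤ 1 - μ lo₁ - μ lo₂ - μ 0 := by linarith
    have h2 : (μ lo₁ + μ lo₂) * γ ≤ (1 - μ lo₁ - μ lo₂ - μ 0) * (1 - γ) := hcap.trans (mul_le_mul_of_nonneg_right h1 h1γ.le)
    nlinarith
  have hlamlt : lam1 + lam2 < 1 := by
    rw [hlam1, hlam2, ← add_div, div_lt_one h1γ]
    have : (1 - γ) * (1 - μ 0) < 1 - γ := by nlinarith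
    linarith
  set lam0 : ℝ := 1 - lam1 - lam2 with hlam0
  have hlam0pos : 0 < lam0 := by rw [hlam0]; linarith
  have hne1 : (1 - γ) ≠ 0 := h1γ.ne'
  have hne0 : lam0 ≠ 0 := hlam0pos.ne'
  have hP1 : P ≠ lo₁ := by omega
  have hP2 : P ≠ lo₂ := by omega
  have h12 : lo₁ ≠ lo₂ := by omega
  -- the remainder
  set ν : ℕ → ℝ := fun h => (μ h - lam1 * TP[lo₁, P, γ, h] - lam2 * TP[lo₂, P, γ, h]) / lam0 with hν
  have e : ∀ h, ν h = (μ h - lam1 * TP[lo₁, P, γ, h] - lam2 * TP[lo₂, P, γ, h]) / lam0 := fun h => rfl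
  clear_value ν lam0 lam1 lam2 γ
  -- values of the two pair laws
  have t11 : TP[lo₁, P, γ, lo₁] = 1 - γ := by rw [if_neg (by omega : lo₁ ≠ P), if_pos rfl]; ring
  have t21 : TP[lo₂, P, γ, lo₁] = 0 := by rw [if_neg (by omega : lo₁ ≠ P), if_neg h12]; ring
  have t12 : TP[lo₁, P, γ, lo₂] = 0 := by rw [if_neg (by omega : lo₂ ≠ P), if_neg (Ne.symm h12)]; ring
  have t22 : TP[lo₂, P, γ, lo₂] = 1 - γ := by rw [if_neg (by omega : lo₂ ≠ P), if_pos rfl]; ring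
  have t1P : TP[lo₁, P, γ, P] = γ := by rw [if_pos rfl, if_neg hP1]; ring
  have t2P : TP[lo₂, P, γ, P] = γ := by rw [if_pos rfl, if_neg hP2]; ring
  have tother : ∀ h, h ≠ lo₁ → h ≠ lo₂ → h ≠ P → TP[lo₁, P, γ, h] = 0 ∧ TP[lo₂, P, γ, h] = 0 := by
    intro h h1 h2 h3
    constructor
    · rw [if_neg h3, if_neg h1]; ring
    · rw [if_neg h3, if_neg h2]; ring
  have hmix : ∀ h, μ h = ∑ b : Bool, (if b then lam1 else lam2) * TP[(if b then lo₁ else lo₂), P, γ, h] + lam0 * ν h := by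
    intro h
    rw [Fintype.sum_bool]
    simp only [if_true, Bool.false_eq_true, if_false]
    rw [e]
    field_simp
    ring
  have hν1 : ν lo₁ = 0 := by
    rw [e, t11, t21, hlam1]
    field_simp
    ring
  have hν2 : ν lo₂ = 0 := by
    rw [e, t12, t22, hlam2]
    field_simp
    ring
  have hνP : 0 ≤ ν P := by
    rw [e, t1P, t2P]
    refine div_nonneg ?_ hlam0pos.le
    have : (lam1 + lam2) * γ ≤ μ P := by
      rw [hlam1, hlam2, ← add_div, div_mul_eq_mul_div, div_le_iff₀ h1γ]
      exact hcap
    linarith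
  have hνother : ∀ h, h ≠ lo₁ → h ≠ lo₂ → h ≠ P → ν h = μ h / lam0 := by
    intro h h1 h2 h3
    rw [e, (tother h h1 h2 h3).1, (tother h h1 h2 h3).2]
    ring
  have hν0 : ∀ h, 0 ≤ ν h := by
    intro h
    by_cases h1 : h = lo₁
    · rw [h1, hν1]
    by_cases h2 : h = lo₂
    · rw [h2, hν2]
    by_cases h3 : h = P
    · rw [h3]; exact hνP
    rw [hνother h h1 h2 h3]; exact div_nonneg (hμ0 h) hlam0pos.le
  have hνM : ∀ h, M < h → ν h = 0 := by
    intro h hh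
    rw [hνother h (by omega) (by omega) (by omega), hμM h hh, zero_div]
  have hνmass : ∑ h ∈ Finset.range (M + 1), ν h = 1 := by
    have e1 : ∑ h ∈ Finset.range (M + 1), ν h
        = (∑ h ∈ Finset.range (M + 1), μ h - lam1 * ∑ h ∈ Finset.range (M + 1), TP[lo₁, P, γ, h]
            - lam2 * ∑ h ∈ Finset.range (M + 1), TP[lo₂, P, γ, h]) / lam0 := by
      rw [Finset.sum_congr rfl fun h _ => e h, Finset.mul_sum, Finset.mul_sum, ← Finset.sum_sub_distrib, ← Finset.sum_sub_distrib,
        Finset.sum_div]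
    rw [e1, hμ1, sum_TP_range M lo₁ P γ hloM₁ hPM, sum_TP_range M lo₂ P γ hloM₂ hPM, mul_one, mul_one, hlam0, div_self]
    rw [← hlam0]; exact hne0
  have hνmean : T ≤ ∑ h ∈ Finset.range (M + 1), (h : ℝ) * ν h := by
    have e1 : ∑ h ∈ Finset.range (M + 1), (h : ℝ) * ν h
        = (∑ h ∈ Finset.range (M + 1), (h : ℝ) * μ h - lam1 * ∑ h ∈ Finset.range (M + 1), (h : ℝ) * TP[lo₁, P, γ, h]
            - lam2 * ∑ h ∈ Finset.range (M + 1), (h : ℝ) * TP[lo₂, P, γ, h]) / lam0 := by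
      rw [Finset.mul_sum, Finset.mul_sum, ← Finset.sum_sub_distrib, ← Finset.sum_sub_distrib, Finset.sum_div]
      refine Finset.sum_congr rfl fun h _ => ?_
      rw [e]
      ring
    rw [e1, hmean, sum_mul_TP_range M lo₁ P γ hloM₁ hPM, sum_mul_TP_range M lo₂ P γ hloM₂ hPM, le_div_iff₀ hlam0pos, hlam0]
    have p1 := mul_nonneg hlam10 (sub_nonneg.2 hm1)
    have p2 := mul_nonneg hlam20 (sub_nonneg.2 hm2)
    linarith [p1, p2]
  have hνbig : ∀ h, 1 ≤ h → 0 < ν h → T ≤ 2 * (h : ℝ) := by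
    intro h h1 hpos
    by_cases hl1 : h = lo₁
    · rw [hl1, hν1] at hpos; exact absurd hpos (lt_irrefl 0)
    by_cases hl2 : h = lo₂
    · rw [hl2, hν2] at hpos; exact absurd hpos (lt_irrefl 0)
    by_cases hP : h = P
    · rw [hP]
      have : (lo₁ : ℝ) < P := by linarith
      linarith
    · refine hothers h h1 hl1 hl2 ?_
      rw [hνother h hl1 hl2 hP] at hpos
      by_contra hle
      have : μ h = 0 := le_antisymm (not_lt.1 hle) (hμ0 h)
      rw [this, zero_div] at hpos
      exact lt_irrefl _ hpos
  -- assemble with the pairs + no-low format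
  intro j'
  refine decAtT_all_of_pairs_noLow (ι := Bool) y T M μ ν (fun b => if b then lam1 else lam2) lam0
    (fun b => if b then lo₁ else lo₂) (fun _ => P) (fun _ => γ) hy0 hy1 hT0 (fun b => ?_) hlam0pos.le ?_ (fun b _ => ?_)
    (fun _ => ⟨hν0, hνM, hνmass, hνbig, hta, hνmean⟩) hmix j'
  · cases b
    · simpa using hlam20
    · simpa using hlam10
  · rw [Fintype.sum_bool]
    simp only [if_true, Bool.false_eq_true, if_false, hlam0]
    ring
  · cases b
    · simp only [Bool.false_eq_true, if_false]
      exact ⟨hloP, hPM, hγ0.le, hγ1.le, hyγ, hcr2⟩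
    · simp only [if_true]
      exact ⟨hlt.trans hloP, hPM, hγ0.le, hγ1.le, hyγ, hcr1⟩

end LawDec
end Quant
end Summit.CriticalPhenomena.PercolationContinuityZ3.Theorems
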